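import Literature.NumberTheory.Rogawski1990.RankOneUnstableRamifiedUnitSimilitudeOnePlace   -- ★ p843591 A-p19 (g23): the one-place package of the ramified partner (`u : L_wˣ`, `|u| = 1`, `σ_w u = u`, `u` not a norm)
import Literature.NumberTheory.Automorphic.UnitaryGroupSelfDualLocusRamifiedPlace               -- ★ ramified place kit: `valued_galAdicCompletionMap_sub_lt_one_of_ramified`, `mem_integer_galAdicCompletionMap`, `natCard_residueField_eq_of_ramified` (transitively)
import Literature.NumberTheory.LocalFields.RamifiedQuadraticNormCriterion                       -- ★ B-p10 (g26): `RamifiedQuadraticNorm.exists_mul_map_eq_of_isSquare_residue` (square residue ⇒ norm, tame)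
import Literature.NumberTheory.Automorphic.AdicCompletionLocalField                              -- ★ `instIsNonarchimedeanLocalFieldAdicCompletion` (⇒ Mathlib `IsAdicComplete 𝓂[L_w] 𝒪[L_w]`)
import Literature.NumberTheory.Automorphic.IwahoriGL                                              -- ★ `residue_eq_zero_iff_valuation_lt_one`
import HarnessLib

/-!
# (R1-ram, R-0c) THE RAMIFIED DISCHARGE PACKAGE — `σ_w` as a residually trivial involution of `𝒪[L_w]` — and THE RESIDUE BIT OF THE UNIT MULTIPLIER: a `σ_w`-fixed unit
# which is not a norm has NON-SQUARE residue at a tamely ramified place (Serre, *Local Fields* V §3; Labesse–Langlands 1979 §2; road «R1-ram», architect A-p16 (g27) A-19∕A-21)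

Topic `NumberTheory/Automorphic`; namespace `Literature.NumberTheory.Automorphic.UnitaryGroup`.  THEOREMS ONLY (no definition, no instance, no notation, no named fact, no `sorry`).
Cell `pub/hodgecm-mathlib` (D-0151), crux H413 = `stmt-HodgeConjecture-24833`, line «N6nsGerm» stub `stub_N6nsR1LL`, residue ★ `RankOneUnstableTransferNonsplitCMERamified`.  HONEST LABEL:
HC_CM is proved only modulo the printed citations (the 2 remaining named inputs hLiu418, h413) until rung 0 closes; this file is unconditional local algebra.

WHY.  The ramified tree road (R-3 ★ B-p12 (g29) `UnitaryRankTwoTorusLocalClassRamified{,Head,Modular,Bit,BitFlip}`, A-p01 (g21) R2-C∕D, A-p16's `exists_vertexCover_of_ramified`) is typed on the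
ABSTRACT frame of ★ B-p10 `LocalFields/RamifiedQuadraticNormCriterion`: a local ring `𝒪` with an involution `σO`, `hσO : ↑(σO x) = σ_w ↑x`, `hσσ : σO ∘ σO = id`, `hres : σO x − x ∈ 𝔪`
(residually trivial = ramified), `h2 : IsUnit (2 : 𝒪)` (tame), and a UNIT `η ∈ 𝒪` with `σO η = η` and `¬ IsSquare (residue η)` — the multiplier of the unit similitude `h = diag(1, η)` of
[LabesseLanglands1979, §2] whose conjugation FLIPS every window bit (★ `normalForm_bit_flip`).  ★ p843548∕p843591 (R-0, R-0b) produce the partner `e = (Ad diag(1, u), id)` with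
`u ∈ 𝒪_wˣ` `σ_w`-fixed and NOT A NORM in `L_w`.  This file (i) packages `(σO, hσO, hσσ, hres, |𝓀_w| = q_v)` at a CONCRETE ramified CM place once and for all — the ramified twin
of ★ A-p13 `exists_integer_involution_of_isUnramifiedIn` (today every consumer rebuilds it inline, e.g. ★ `exists_mem_unitaryGroupOfForm_mul_of_selfDual_of_ramified`) — and
(ii) proves the RESIDUE BIT: at a tame place a `σ_w`-fixed unit which is not a norm has non-square residue (contrapositive of ★ B-p10 `exists_mul_map_eq_of_isSquare_residue`,
Serre V §3: `N U_L = {u : ū ∈ 𝓀ˣ²}`), so `η := u` IS B-p12's non-square unit.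

* §1 `exists_integer_involution_of_ramified` (generic quadratic `E ∕ F`, `c`) and its CM dress `exists_integer_involution_complexConj_of_ramified`.
* §2 `isUnit_integer_of_v_eq_one`, `isUnit_two_integer_of_v_two_eq_one` (A-p16's `h2 : Valued.v (2 : L_w) = 1` ⇒ B-p12's `h2 : IsUnit (2 : 𝒪)`),
  **`not_isSquare_residue_of_not_exists_norm`** (the residue bit).
* §3 THE DRESS on ★ p843591: **`exists_unitSimilitudePartner_residueBit_of_ramified`** — at a TAMELY ramified `w`, `∃ σO r hru (u : L_wˣ) (η : 𝒪[L_w]) (e : H_v ≃ₜ* H_v)` with the §1 clauses,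
  `↑η = ↑u = r_w`, `IsUnit η`, `σO η = η`, `¬ IsSquare (residue η)`, and the partner clauses of ★ p843548∕p843591 (LocalRing formula `(e a).1 = T_r a.1 T_r⁻¹`, FRAME
  `(e t).1·(T_r P) = (T_r P)·diag(τ₀ t, τ₁ t)`, `hτst`, Haar, `K_H`-level, `E_w((e a).1) = D_u·E_w(a.1)·D_u⁻¹`, `D_u ∈ GL₂(𝒪_w)`, level family) — EXACTLY the tuple
  `(σO, hσO, hσσ, hres, h2, η, hηu, hση, hη)` B-p12's ★ `normalForm_bit_flip` consumes, glued to ★ L1's partner `e` and its frame ((R5b-β) assembler F0P3a-p03 (g12)'s ask 10:28:29Z).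

## References
* [Serre1979] J.-P. Serre, *Local Fields*, GTM 67 (1979): Ch. V §3 Prop. 5, Cor. 2 (`N U_L` in the totally ramified case).
* [LabesseLanglands1979] J.-P. Labesse, R. P. Langlands, *L-indistinguishability for SL(2)*, Canad. J. Math. 31 (1979): §2 pp. 8–10.
* [NeukirchANT1999] J. Neukirch, *Algebraic Number Theory* (1999): Ch. I §9 Prop. (9.6), Ch. II §4 (inertia at a ramified prime).
* [Rogawski1990] J. D. Rogawski, *Automorphic Representations of Unitary Groups in Three Variables*, Ann. of Math. Stud. 123 (1990): §4.9 Lemma 4.9.3 p. 56.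
-/

set_option autoImplicit false

noncomputable section

open NumberField IsDedekindDomain ValuativeRel MeasureTheory Matrix
open scoped ValuativeRel MatrixGroups

namespace Literature.NumberTheory.Automorphic.UnitaryGroup

/-! ## §1 The ramified discharge package: `σ_w` restricted to `𝒪[E_w]` is a residually trivial involution, `|𝓀_w| = q_v` -/

section Package

variable {F : Type} (E : Type) [Field F] [NumberField F] [Field E] [NumberField E] [Algebra F E] [Algebra.IsQuadraticExtension F E]
  (c : E ≃ₐ[F] E) (hc : c ≠ 1) (v : HeightOneSpectrum (𝓞 F)) (w : PlacesOver E v) (hw : c • w.1 = w.1)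

include hc in
/-- **THE RAMIFIED DISCHARGE PACKAGE.**  At a RAMIFIED non-split place (`c ≠ 1`, `c • w = w`, `e(w|v) ≠ 1`) the local involution `σ_w = galAdicCompletionMap c hw` restricts to a ring
involution `σO` of the valuation ring `𝒪[E_w]` (★ `mem_integer_galAdicCompletionMap`) which is RESIDUALLY TRIVIAL — `σO x − x ∈ 𝔪_w` for every `x` (★
`valued_galAdicCompletionMap_sub_lt_one_of_ramified`: `c` lies in the inertia group) — and the residue field has `q_v = |𝓞_F ∕ v|` elements (`f(w|v) = 1`, ★
`natCard_residueField_eq_of_ramified`).  The binders `(σO, hσO, hσσ, hres)` of the abstract ramified files (★ `RamifiedQuadraticNormCriterion`, ★ `UnitaryRankTwoTorusLocalClassRamified*`),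
discharged; ramified twin of ★ `exists_integer_involution_of_isUnramifiedIn`. [cite: NeukirchANT1999, Ch. I §9 Prop. (9.6); Ch. II §4] [cite: Serre1979, Ch. V §3] -/
theorem exists_integer_involution_of_ramified (he : v.asIdeal.ramificationIdx' w.1.asIdeal ≠ 1) :
    ∃ σO : 𝒪[w.1.adicCompletion E] →+* 𝒪[w.1.adicCompletion E],
      (∀ x : 𝒪[w.1.adicCompletion E], ((σO x : 𝒪[w.1.adicCompletion E]) : w.1.adicCompletion E) = galAdicCompletionMap (L := E) c hw x) ∧
      (∀ x, σO (σO x) = x) ∧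
      (∀ x, σO x - x ∈ IsLocalRing.maximalIdeal 𝒪[w.1.adicCompletion E]) ∧
      Nat.card (IsLocalRing.ResidueField 𝒪[w.1.adicCompletion E]) = Nat.card (𝓞 F ⧸ v.asIdeal) := by
  classical
  set K := w.1.adicCompletion E
  have hσO : ∀ x : 𝒪[K], galAdicCompletionMap (L := E) c hw x ∈ 𝒪[K] := fun x => mem_integer_galAdicCompletionMap c v w hw x
  let σO : 𝒪[K] →+* 𝒪[K] := ((galAdicCompletionMap (L := E) c hw).comp (𝒪[K]).subtype).codRestrict 𝒪[K] fun x => hσO x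
  have hσO' : ∀ x : 𝒪[K], ((σO x : 𝒪[K]) : K) = galAdicCompletionMap (L := E) c hw x := fun _ => rfl
  have hσσ : ∀ x, σO (σO x) = x := fun x => Subtype.ext (galAdicCompletionMap_galAdicCompletionMap_of_smul_eq c w hc hw (x : K))
  -- the bridge `𝔪_w = {Valued.v < 1}`
  have hmem : ∀ x : 𝒪[K], x ∈ IsLocalRing.maximalIdeal 𝒪[K] ↔ Valued.v (x : K) < 1 := fun x => by
    rw [← IsLocalRing.residue_eq_zero_iff, residue_eq_zero_iff_valuation_lt_one, v_lt_one_iff_valuation_lt_one]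
  have hle : ∀ x : 𝒪[K], Valued.v (x : K) ≤ 1 := fun x => (v_le_one_iff_mem_integer (x : K)).2 x.2
  have hres : ∀ x : 𝒪[K], σO x - x ∈ IsLocalRing.maximalIdeal 𝒪[K] := fun x => by
    rw [hmem]
    exact Liu2021.LemD1IndexedNonVacuityRamifiedConverse.valued_galAdicCompletionMap_sub_lt_one_of_ramified E c v hc w hw he (x : K) (hle x)
  exact ⟨σO, hσO', hσσ, hres, natCard_residueField_eq_of_ramified c v hc w hw he⟩

end Package

/-! ## §2 The residue bit: a `σ`-fixed unit which is not a norm has non-square residue (tame) -/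

section ResidueBit

variable {K : Type} [Field K] [NumberField K] (w : HeightOneSpectrum (𝓞 K))

/-- `|u|_w = 1 ⇒ u` is a unit of `𝒪[K_w]`. [cite: Serre1979, Ch. V §3] -/
theorem isUnit_integer_of_v_eq_one {u : w.adicCompletion K} (hu : Valued.v u = 1) :
    IsUnit (⟨u, (v_le_one_iff_mem_integer u).1 hu.le⟩ : 𝒪[w.adicCompletion K]) :=
  (Valuation.integer.integers (valuation (w.adicCompletion K))).isUnit_iff_valuation_eq_one.2 ((v_eq_one_iff_valuation_eq_one u).1 hu)

/-- `|2|_w = 1 ⇒ 2` is a unit of `𝒪[K_w]` (the TAME binder: A-p16's spelling `Valued.v (2 : L_w) = 1` ⇒ B-p12's `IsUnit (2 : 𝒪)`). [cite: Serre1979, Ch. V §3] -/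
theorem isUnit_two_integer_of_v_two_eq_one (h2 : Valued.v (2 : w.adicCompletion K) = 1) : IsUnit (2 : 𝒪[w.adicCompletion K]) := by
  exact isUnit_integer_of_v_eq_one w h2

/-- **THE RESIDUE BIT: at a tamely ramified place a `σ`-fixed unit which is NOT a norm has NON-SQUARE residue.**  `𝒪 = 𝒪[K_w]` (complete), `σ : K_w →+* K_w` with an
integral restriction `σO` (`↑(σO x) = σ ↑x`) which is a residually trivial involution, `2 ∈ 𝒪ˣ`; for `u ∈ K_w` with `|u| = 1`, `σ u = u` and `u ≠ σ(z)·z` for all `z ∈ K_w`: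
`ū ∉ 𝓀ˣ²`.  (If `ū` were a square, ★ `exists_mul_map_eq_of_isSquare_residue` — Serre's `N U_L ⊇ U_K ∩ 𝓀ˣ²` — would write `u = s·σ s`.)  This makes the unit multiplier `u` of
the R-0 partner (★ p843591) the non-square `η` of ★ `normalForm_bit_flip`. [cite: Serre1979, Ch. V §3 Prop. 5 and Cor. 2] [cite: LabesseLanglands1979, §2 pp. 8–9] -/
theorem not_isSquare_residue_of_not_exists_norm (σ : w.adicCompletion K →+* w.adicCompletion K)
    (σO : 𝒪[w.adicCompletion K] →+* 𝒪[w.adicCompletion K])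
    (hσO : ∀ x : 𝒪[w.adicCompletion K], ((σO x : 𝒪[w.adicCompletion K]) : w.adicCompletion K) = σ x)
    (hσσ : ∀ x, σO (σO x) = x) (hres : ∀ x, σO x - x ∈ IsLocalRing.maximalIdeal 𝒪[w.adicCompletion K]) (h2 : IsUnit (2 : 𝒪[w.adicCompletion K]))
    {u : w.adicCompletion K} (hu : Valued.v u = 1) (hσu : σ u = u) (hn : ¬ ∃ z : w.adicCompletion K, u = σ z * z) :
    ¬ IsSquare (IsLocalRing.residue 𝒪[w.adicCompletion K] ⟨u, (v_le_one_iff_mem_integer u).1 hu.le⟩) := by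
  intro hsq
  have huO : IsUnit (⟨u, (v_le_one_iff_mem_integer u).1 hu.le⟩ : 𝒪[w.adicCompletion K]) := isUnit_integer_of_v_eq_one w hu
  have hσuO : σO ⟨u, (v_le_one_iff_mem_integer u).1 hu.le⟩ = ⟨u, (v_le_one_iff_mem_integer u).1 hu.le⟩ := Subtype.ext (by rw [hσO]; exact hσu)
  obtain ⟨s, hs⟩ := Literature.NumberTheory.LocalFields.RamifiedQuadraticNorm.exists_mul_map_eq_of_isSquare_residue σO hσσ hres h2 huO hσuO hsq
  refine hn ⟨(s : w.adicCompletion K), ?_⟩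
  have h := congrArg (fun x : 𝒪[w.adicCompletion K] => (x : w.adicCompletion K)) hs
  simp only [Subring.coe_mul] at h
  rw [hσO] at h
  rw [← h, mul_comm]

end ResidueBit

/-! ## §3 CM dress: the package and the residue bit of the R-0 unit multiplier at a tamely ramified place of `L ∕ L⁺` -/

section CM

variable (L : Type) [Field L] [NumberField L] [IsCMField L] (v : HeightOneSpectrum (𝓞 ↥(maximalRealSubfield L)))

/-- **CM DRESS OF THE PACKAGE**: at a ramified non-split place of `L ∕ L⁺` (`c` = complex conjugation). [cite: NeukirchANT1999, Ch. I §9 Prop. (9.6); Ch. II §4] [cite: Serre1979, Ch. V §3] -/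
theorem exists_integer_involution_complexConj_of_ramified (w : PlacesOver L v) (hw : IsCMField.complexConj L • w.1 = w.1)
    (he : v.asIdeal.ramificationIdx' w.1.asIdeal ≠ 1) :
    ∃ σO : 𝒪[w.1.adicCompletion L] →+* 𝒪[w.1.adicCompletion L],
      (∀ x : 𝒪[w.1.adicCompletion L], ((σO x : 𝒪[w.1.adicCompletion L]) : w.1.adicCompletion L) = galAdicCompletionMap (L := L) (IsCMField.complexConj L) hw x) ∧
      (∀ x, σO (σO x) = x) ∧
      (∀ x, σO x - x ∈ IsLocalRing.maximalIdeal 𝒪[w.1.adicCompletion L]) ∧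
      Nat.card (IsLocalRing.ResidueField 𝒪[w.1.adicCompletion L]) = Nat.card (𝓞 ↥(maximalRealSubfield L) ⧸ v.asIdeal) :=
  exists_integer_involution_of_ramified L (IsCMField.complexConj L) (IsCMField.complexConj_ne_one L) v w hw he

/-- **THE RAMIFIED PARTNER WITH ITS RESIDUE BIT (R-0c dress on ★ p843591).**  At a TAMELY ramified non-split place `w ∣ v` (`e(w|v) ≠ 1`, `|2|_w = 1`), for an elliptic regular
frame `(t₀, P, d)` of `H_v`: there are the residually trivial involution `σO` of `𝒪[L_w]` (§1), a unit `u ∈ L_wˣ` with its integral copy `η ∈ 𝒪[L_w]` (`↑η = ↑u`, `IsUnit η`,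
`σO η = η`, **`¬ IsSquare (residue η)`**, `|u| = 1`), and the partner `e : H_v ≃ₜ* H_v` of ★ `exists_unitSimilitudePartner_onePlace_of_ramified` with: `e t` stably conjugate and NOT
conjugate to `t` at regular `t ∈ Z(t₀)`; `MeasurePreserving e ν ν` for every Haar `ν`; `e K_H = K_H`; `E_w((e a).1) = D_u · E_w(a.1) · D_u⁻¹` with `D_u = diag(1, u) ∈ GL₂(𝒪_w)`; and the
level family.  I.e. the tuple `(σO, hσO, hσσ, hres, h2, η, hηu, hση, hη)` of ★ B-p12 `normalForm_bit_flip{,_modular}` ∕ `localClass_normalForm_ramified{,_modular}`, glued to the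
`hest`-partner of ★ L1 `rankOneUnstable_core_inert_of_eventually`. [cite: LabesseLanglands1979, §2 pp. 8–10] [cite: Serre1979, Ch. V §3 Cor. 2] [cite: Rogawski1990, §4.9 Lemma 4.9.3 p. 56] -/
theorem exists_unitSimilitudePartner_residueBit_of_ramified (w : PlacesOver L v) (hw : IsCMField.complexConj L • w.1 = w.1)
    (he : v.asIdeal.ramificationIdx' w.1.asIdeal ≠ 1) (h2 : Valued.v (2 : w.1.adicCompletion L) = 1) [MeasurableSpace ((cmDatum L 2 (Matrix.of fun i j : Fin 2 => if i.val + j.val + 1 = 2 then (1 : L) else 0)).Local v × (cmDatum L 1 (Matrix.of fun i j : Fin 1 => if i.val + j.val + 1 = 1 then (1 : L) else 0)).Local v)] [BorelSpace ((cmDatum L 2 (Matrix.of fun i j : Fin 2 => if i.val + j.val + 1 = 2 then (1 : L) else 0)).Local v × (cmDatum L 1 (Matrix.of fun i j : Fin 1 => if i.val + j.val + 1 = 1 then (1 : L) else 0)).Local v)]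
    (t₀ : ((cmDatum L 2 (Matrix.of fun i j : Fin 2 => if i.val + j.val + 1 = 2 then (1 : L) else 0)).Local v × (cmDatum L 1 (Matrix.of fun i j : Fin 1 => if i.val + j.val + 1 = 1 then (1 : L) else 0)).Local v)) (P : GL (Fin 2) (LocalRing L v)) (d : Fin 2 → (LocalRing L v)) (ht₀ : Rogawski1990.IsRegularElt (t₀.1.val : GL (Fin 2) (LocalRing L v)))
    (hP : (t₀.1.val.val : Matrix (Fin 2) (Fin 2) (LocalRing L v)) * P.val = P.val * Matrix.diagonal d) (hd1 : ∀ i, conjLocal L (IsCMField.complexConj L) v (d i) * d i = 1) :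
    ∃ (σO : 𝒪[(w.1.adicCompletion L)] →+* 𝒪[(w.1.adicCompletion L)]) (r : LocalRing L v) (hru : IsUnit r) (u : ((w.1.adicCompletion L))ˣ) (η : 𝒪[(w.1.adicCompletion L)]) (e : ((cmDatum L 2 (Matrix.of fun i j : Fin 2 => if i.val + j.val + 1 = 2 then (1 : L) else 0)).Local v × (cmDatum L 1 (Matrix.of fun i j : Fin 1 => if i.val + j.val + 1 = 1 then (1 : L) else 0)).Local v) ≃ₜ* ((cmDatum L 2 (Matrix.of fun i j : Fin 2 => if i.val + j.val + 1 = 2 then (1 : L) else 0)).Local v × (cmDatum L 1 (Matrix.of fun i j : Fin 1 => if i.val + j.val + 1 = 1 then (1 : L) else 0)).Local v)),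
      (∀ x : 𝒪[(w.1.adicCompletion L)], ((σO x : 𝒪[(w.1.adicCompletion L)]) : (w.1.adicCompletion L)) = (galAdicCompletionMap (L := L) (IsCMField.complexConj L) hw) x) ∧ (∀ x, σO (σO x) = x) ∧ (∀ x, σO x - x ∈ IsLocalRing.maximalIdeal 𝒪[(w.1.adicCompletion L)]) ∧
      IsUnit (2 : 𝒪[(w.1.adicCompletion L)]) ∧
      ((η : (w.1.adicCompletion L)) = (u : (w.1.adicCompletion L))) ∧ IsUnit η ∧ σO η = η ∧ ¬ IsSquare (IsLocalRing.residue 𝒪[(w.1.adicCompletion L)] η) ∧ Valued.v (u : (w.1.adicCompletion L)) = 1 ∧ ((u : (w.1.adicCompletion L)) = r w) ∧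
      (∀ a : ((cmDatum L 2 (Matrix.of fun i j : Fin 2 => if i.val + j.val + 1 = 2 then (1 : L) else 0)).Local v × (cmDatum L 1 (Matrix.of fun i j : Fin 1 => if i.val + j.val + 1 = 1 then (1 : L) else 0)).Local v), ((e a).1.val : GL (Fin 2) (LocalRing L v)) = glDiagonal 2 (LocalRing L v) ![1, hru.unit] * a.1.val * (glDiagonal 2 (LocalRing L v) ![1, hru.unit])⁻¹ ∧
        (e a).2 = a.2) ∧
      (∀ t : ↥(Subgroup.centralizer ({t₀} : Set ((cmDatum L 2 (Matrix.of fun i j : Fin 2 => if i.val + j.val + 1 = 2 then (1 : L) else 0)).Local v × (cmDatum L 1 (Matrix.of fun i j : Fin 1 => if i.val + j.val + 1 = 1 then (1 : L) else 0)).Local v))), ((e (t : ((cmDatum L 2 (Matrix.of fun i j : Fin 2 => if i.val + j.val + 1 = 2 then (1 : L) else 0)).Local v × (cmDatum L 1 (Matrix.of fun i j : Fin 1 => if i.val + j.val + 1 = 1 then (1 : L) else 0)).Local v))).1.val.val : Matrix (Fin 2) (Fin 2) (LocalRing L v)) * (glDiagonal 2 (LocalRing L v) ![1, hru.unit] * P).val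 =
        (glDiagonal 2 (LocalRing L v) ![1, hru.unit] * P).val * Matrix.diagonal ![((P⁻¹).val * ((t : ((cmDatum L 2 (Matrix.of fun i j : Fin 2 => if i.val + j.val + 1 = 2 then (1 : L) else 0)).Local v × (cmDatum L 1 (Matrix.of fun i j : Fin 1 => if i.val + j.val + 1 = 1 then (1 : L) else 0)).Local v)).1.val.val : Matrix (Fin 2) (Fin 2) (LocalRing L v)) * P.val) 0 0, ((P⁻¹).val * ((t : ((cmDatum L 2 (Matrix.of fun i j : Fin 2 => if i.val + j.val + 1 = 2 then (1 : L) else 0)).Local v × (cmDatum L 1 (Matrix.of fun i j : Fin 1 => if i.val + j.val + 1 = 1 then (1 : L) else 0)).Local v)).1.val.val : Matrix (Fin 2) (Fin 2) (LocalRing L v)) * P.val) 1 1]) ∧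
      (∀ t : ↥(Subgroup.centralizer ({t₀} : Set ((cmDatum L 2 (Matrix.of fun i j : Fin 2 => if i.val + j.val + 1 = 2 then (1 : L) else 0)).Local v × (cmDatum L 1 (Matrix.of fun i j : Fin 1 => if i.val + j.val + 1 = 1 then (1 : L) else 0)).Local v))), Rogawski1990.IsRegularElt ((t : ((cmDatum L 2 (Matrix.of fun i j : Fin 2 => if i.val + j.val + 1 = 2 then (1 : L) else 0)).Local v × (cmDatum L 1 (Matrix.of fun i j : Fin 1 => if i.val + j.val + 1 = 1 then (1 : L) else 0)).Local v)).1.val : GL (Fin 2) (LocalRing L v)) →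
        Rogawski1990.IsLocalStablyConjH L v (t : ((cmDatum L 2 (Matrix.of fun i j : Fin 2 => if i.val + j.val + 1 = 2 then (1 : L) else 0)).Local v × (cmDatum L 1 (Matrix.of fun i j : Fin 1 => if i.val + j.val + 1 = 1 then (1 : L) else 0)).Local v)) (e (t : ((cmDatum L 2 (Matrix.of fun i j : Fin 2 => if i.val + j.val + 1 = 2 then (1 : L) else 0)).Local v × (cmDatum L 1 (Matrix.of fun i j : Fin 1 => if i.val + j.val + 1 = 1 then (1 : L) else 0)).Local v))) ∧ ¬ IsConj (t : ((cmDatum L 2 (Matrix.of fun i j : Fin 2 => if i.val + j.val + 1 = 2 then (1 : L) else 0)).Local v × (cmDatum L 1 (Matrix.of fun i j : Fin 1 => if i.val + j.val + 1 = 1 then (1 : L) else 0)).Local v)) (e (t : ((cmDatum L 2 (Matrix.of fun i j : Fin 2 => if i.val + j.val + 1 = 2 then (1 : L) else 0)).Local v × (cmDatum L 1 (Matrix.of fun i j : Fin 1 => if i.val + j.val + 1 = 1 then (1 : L) else 0)).Local v)))) ∧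
      (∀ (ν : Measure ((cmDatum L 2 (Matrix.of fun i j : Fin 2 => if i.val + j.val + 1 = 2 then (1 : L) else 0)).Local v × (cmDatum L 1 (Matrix.of fun i j : Fin 1 => if i.val + j.val + 1 = 1 then (1 : L) else 0)).Local v)) [ν.IsHaarMeasure], MeasurePreserving e ν ν) ∧
      (∀ a : ((cmDatum L 2 (Matrix.of fun i j : Fin 2 => if i.val + j.val + 1 = 2 then (1 : L) else 0)).Local v × (cmDatum L 1 (Matrix.of fun i j : Fin 1 => if i.val + j.val + 1 = 1 then (1 : L) else 0)).Local v), e a ∈ ((cmLocalIntegralLevel L 2 (Matrix.of fun i j : Fin 2 => if i.val + j.val + 1 = 2 then (1 : L) else 0) v).prod (cmLocalIntegralLevel L 1 (Matrix.of fun i j : Fin 1 => if i.val + j.val + 1 = 1 then (1 : L) else 0) v) : Subgroup ((cmDatum L 2 (Matrix.of fun i j : Fin 2 => if i.val + j.val + 1 = 2 then (1 : L) else 0)).Local v × (cmDatum L 1 (Matrix.of fun i j : Fin 1 => if i.val + j.val + 1 = 1 then (1 : L) else 0)).Local v)) ↔ a ∈ ((cmLocalIntegralLevel L 2 (Matrix.of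 fun i j : Fin 2 => if i.val + j.val + 1 = 2 then (1 : L) else 0) v).prod (cmLocalIntegralLevel L 1 (Matrix.of fun i j : Fin 1 => if i.val + j.val + 1 = 1 then (1 : L) else 0) v) : Subgroup ((cmDatum L 2 (Matrix.of fun i j : Fin 2 => if i.val + j.val + 1 = 2 then (1 : L) else 0)).Local v × (cmDatum L 1 (Matrix.of fun i j : Fin 1 => if i.val + j.val + 1 = 1 then (1 : L) else 0)).Local v))) ∧
      (∀ a : ((cmDatum L 2 (Matrix.of fun i j : Fin 2 => if i.val + j.val + 1 = 2 then (1 : L) else 0)).Local v × (cmDatum L 1 (Matrix.of fun i j : Fin 1 => if i.val + j.val + 1 = 1 then (1 : L) else 0)).Local v), (((localNonsplitEquiv (IsCMField.complexConj L) (Matrix.of fun i j : Fin 2 => if i.val + j.val + 1 = 2 then (1 : L) else 0) (IsCMField.complexConj_ne_one L) w hw) (e a).1 : ↥(unitaryGroupOfForm (galAdicCompletionMap (L := L) (IsCMField.complexConj L) hw) (placeForm (Matrix.of fun i j : Fin 2 => if i.val + j.val + 1 = 2 then (1 : L) else 0) w.1))) : GL (Fin 2) (w.1.adicCompletion L)) 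=
        glDiagonal 2 (w.1.adicCompletion L) ![1, u] * (((localNonsplitEquiv (IsCMField.complexConj L) (Matrix.of fun i j : Fin 2 => if i.val + j.val + 1 = 2 then (1 : L) else 0) (IsCMField.complexConj_ne_one L) w hw) a.1 : ↥(unitaryGroupOfForm (galAdicCompletionMap (L := L) (IsCMField.complexConj L) hw) (placeForm (Matrix.of fun i j : Fin 2 => if i.val + j.val + 1 = 2 then (1 : L) else 0) w.1))) : GL (Fin 2) (w.1.adicCompletion L)) * (glDiagonal 2 (w.1.adicCompletion L) ![1, u])⁻¹) ∧
      glDiagonal 2 (w.1.adicCompletion L) ![1, u] ∈ glInt 2 (w.1.adicCompletion L) ∧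
      ∀ S : Subgroup (GL (Fin 2) (w.1.adicCompletion L)), (∀ s, glDiagonal 2 (w.1.adicCompletion L) ![1, u] * s * (glDiagonal 2 (w.1.adicCompletion L) ![1, u])⁻¹ ∈ S ↔ s ∈ S) →
        ∀ a : ((cmDatum L 2 (Matrix.of fun i j : Fin 2 => if i.val + j.val + 1 = 2 then (1 : L) else 0)).Local v × (cmDatum L 1 (Matrix.of fun i j : Fin 1 => if i.val + j.val + 1 = 1 then (1 : L) else 0)).Local v), (((localNonsplitEquiv (IsCMField.complexConj L) (Matrix.of fun i j : Fin 2 => if i.val + j.val + 1 = 2 then (1 : L) else 0) (IsCMField.complexConj_ne_one L) w hw) (e a).1 : ↥(unitaryGroupOfForm (galAdicCompletionMap (L := L) (IsCMField.complexConj L) hw) (placeForm (Matrix.of fun i j : Fin 2 => if i.val + j.val + 1 = 2 then (1 : L) else 0) w.1))) : GL (Fin 2) (w.1.adicCompletion L)) ∈ S ↔ (((localNonsplitEquiv (IsCMField.complexConj L) (Matrix.of fun i j : Fin 2 => if i.val + j.val + 1 = 2 then (1 : L) else 0) (IsCMField.complexConj_ne_one L) w hw) a.1 : ↥(unitaryGroupOfForm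 (galAdicCompletionMap (L := L) (IsCMField.complexConj L) hw) (placeForm (Matrix.of fun i j : Fin 2 => if i.val + j.val + 1 = 2 then (1 : L) else 0) w.1))) : GL (Fin 2) (w.1.adicCompletion L)) ∈ S := by
  obtain ⟨σO, hσO, hσσ, hres, -⟩ := exists_integer_involution_complexConj_of_ramified L v w hw he
  obtain ⟨r, hru, u, e, -, -, -, hAd, hframe, hest, hK, hν, huval, hvu, hσu, hnn, hconj, hDint, hlev⟩ :=
    Rogawski1990.exists_unitSimilitudePartner_onePlace_of_ramified L v w hw he t₀ P d ht₀ hP hd1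
  have h2O : IsUnit (2 : 𝒪[(w.1.adicCompletion L)]) := isUnit_two_integer_of_v_two_eq_one w.1 h2
  refine ⟨σO, r, hru, u, ⟨(u : (w.1.adicCompletion L)), (v_le_one_iff_mem_integer (u : (w.1.adicCompletion L))).1 hvu.le⟩, e, hσO, hσσ, hres, h2O, rfl, isUnit_integer_of_v_eq_one w.1 hvu,
    Subtype.ext (by rw [hσO]; exact hσu), ?_, hvu, huval, hAd, hframe, hest, hν, hK, hconj, hDint, hlev⟩
  exact not_isSquare_residue_of_not_exists_norm w.1 (galAdicCompletionMap (L := L) (IsCMField.complexConj L) hw) σO hσO hσσ hres h2O hvu hσu hnn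

end CM

end Literature.NumberTheory.Automorphic.UnitaryGroup

end
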